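import Summits.CriticalPhenomena.PercolationContinuityZ3.Theorems.PercNearOneGluingNoHeavyLowerTailKnQuestion8CoefficientwiseOffCluster
import Summits.CriticalPhenomena.PercolationContinuityZ3.Theorems.PercNearOneGluingNoHeavyLowerTailKnQuestion8AntitheticProduct
import HarnessLib

/-!
# The star-class sums of NO-CORE(y) are nonnegative when `f` is the indicator of a red neighbour of `y` ('Harris twice' with an inactive star) — prim-lf-2 gen 48

Support file (`--supports stmt-CriticalPhenomena-4575`, closed), prover `prim-lf-2` (gen 48).  No definitions, no named facts, no sorries; standard axioms.
Memo `prim-lf-2/CW-HT-gen48.md` §3b.  Companion (part 2, `…KnQuestion8CoefficientwiseNoCoreAdjPoint.lean`): the star resolution `NO-CORE(y) = Σ_{R ⊆ δ(y)} C_R` and the theorem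
'NO-CORE(y) ≥ 0 for every vertex `y` adjacent to a point'.

Setting.  Finite multigraph `ends : ι → Sym2 V`, root `x`; `K(s) = openCluster (ends '' s) x`.  Fix a vertex `y ≠ x`, a set `D` of edges containing ALL edges at `y`, and `R ⊆ D`
(the edges at `y` that are RED; `D ∖ R` are blue).  The remaining edges form the sub-cube `Finset {j // j ∉ D}`; for `r` in it write `r⁺ = r.map val` and
  `a(r) = K(r⁺ ∪ R)` (red cluster),  `b(r) = K((rᶜ)⁺ ∪ (D ∖ R))` (blue cluster)   — the clusters of the colouring `r⁺ ∪ R` of the whole graph;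
the STAR CLASS SUM of NO-CORE(y) is `C_R := Σ_r [¬(y ∈ a(r) ∧ y ∈ b(r))]·(f(a r) − f(b r))·(g(a r) − g(b r))` (gen 46's PAIR-CLAIM slice; for `|δ(y)| = 2`, `R = {yp}` it is
`Q_mix^{G−y}(p,q)`).  THEOREM (`starClass_nonneg_of_pointIndicator`): if some edge `e₀ ∈ R` joins `y` to `p`, then `C_R ≥ 0` for `f = 1[p ∈ ·]` and EVERY monotone `g`.
Proof (memo §3b): with `a′(r) = K(r⁺ ∪ (D∖R))`, `b′(r) = K((rᶜ)⁺ ∪ R)` (the swapped class), `[y ∈ a] = [p ∈ a]` (the red edge `e₀`) and folding the `p`-blue-only part through `r ↦ rᶜ`,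
  `C_R = Σ E₁·(g a − g b) + Σ E₂·(g a′ − g b′)`,  `E₁ = [p∈a][p∉b][y∉b]`, `E₂ = [p∈a′][p∉b′]` (both monotone in `r`);
then `g a − g b = (g a(r) − g a(rᶜ)) + (g b′ − g b)` and `g a′ − g b′ = (g a′(r) − g a′(rᶜ)) + (g b − g b′)`: the first summands give antithetic kernels
(`AntitheticProduct.sum_mul_sub_compl_nonneg`), the second ones are `≥ 0` TERMWISE because on `E₁` the blue star is inactive (`y ∉ b ⇒ b = K((rᶜ)⁺ ∪ (D∖R)) ⊆ K((rᶜ)⁺) ⊆ b′`,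
`openCluster_union_star_subset`) and on `E₂` the red-edges-turned-blue star is inactive (`p ∉ b′ ⇒ y ∉ b′ ⇒ b′ ⊆ b`).
[cite: KozmaNitzan2024, Questions 8–9 (§5.5 p. 36) (context: the Question-8 pocket covariance programme)]
-/

namespace Summit.CriticalPhenomena.PercolationContinuityZ3.Theorems

open Finset Literature.Probability.Percolation

namespace Coefficientwise

variable {ι V : Type*} [Fintype ι] [DecidableEq ι] (ends : ι → Sym2 V) (x : V)

omit [Fintype ι] in
/-- **Inactive star.**  If every edge of `A` contains `y` and `y ∉ C_x(T ∪ A)`, then `C_x(T ∪ A) ⊆ C_x(T)`: no path from `x` can use an edge at the unreached vertex `y`.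
[cite: KozmaNitzan2024, §5.5 (context only; elementary)] -/
theorem openCluster_union_star_subset (T A : Finset ι) {y : V} (hA : ∀ i ∈ A, y ∈ ends i)
    (hy : y ∉ openCluster (ends '' (↑(T ∪ A) : Set ι)) x) :
    openCluster (ends '' (↑(T ∪ A) : Set ι)) x ⊆ openCluster (ends '' (↑T : Set ι)) x := by
  intro v hv
  obtain ⟨walk⟩ := hv
  have htr : ∀ a ∈ openCluster (ends '' (↑(T ∪ A) : Set ι)) x, ∀ b, (openGraph (ends '' (↑(T ∪ A) : Set ι))).Adj a b →
      (openGraph (ends '' (↑T : Set ι))).Adj a b ∧ b ∈ openCluster (ends '' (↑(T ∪ A) : Set ι)) x := by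
    intro a ha b hab
    have hb : b ∈ openCluster (ends '' (↑(T ∪ A) : Set ι)) x := SimpleGraph.Reachable.trans ha hab.reachable
    refine ⟨?_, hb⟩
    rw [openGraph_image_adj] at hab ⊢
    obtain ⟨⟨i, hi, hiab⟩, hne⟩ := hab
    rcases Finset.mem_union.mp (Finset.mem_coe.mp hi) with hiT | hiA
    · exact ⟨⟨i, hiT, hiab⟩, hne⟩
    · exfalso
      have hyi := hA i hiA
      rw [hiab, Sym2.mem_iff] at hyi
      rcases hyi with rfl | rfl
      · exact hy ha
      · exact hy hb
  exact ((reachable_transfer (openCluster (ends '' (↑(T ∪ A) : Set ι)) x) htr walk) (mem_openCluster_self _ x)).1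

omit [Fintype ι] [DecidableEq ι] in
/-- If the edge `e₀ = {y, p}` is red then `y` is red-reached iff `p` is. [cite: KozmaNitzan2024, §5.5 (context only; elementary)] -/
theorem mem_openCluster_iff_of_edge (S : Finset ι) {y p : V} {e₀ : ι} (he₀ : ends e₀ = s(y, p)) (hpy : p ≠ y) (he₀S : e₀ ∈ S) :
    y ∈ openCluster (ends '' (↑S : Set ι)) x ↔ p ∈ openCluster (ends '' (↑S : Set ι)) x := by
  have hadj : (openGraph (ends '' (↑S : Set ι))).Adj y p := by
    rw [openGraph_image_adj]; exact ⟨⟨e₀, he₀S, he₀⟩, hpy.symm⟩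
  exact ⟨fun h => SimpleGraph.Reachable.trans h hadj.reachable, fun h => SimpleGraph.Reachable.trans h hadj.symm.reachable⟩

open Classical in
/-- **The star-class sum is nonnegative for the indicator of a red neighbour.**  Let `y ≠ x`, let `D ⊇ δ(y)` contain only edges at `y` … precisely: every edge of `D`
contains `y`, `R ⊆ D`, and `e₀ ∈ R` has ends `{y, p}`, `p ≠ y`.  For the sub-cube `r : Finset {j // j ∉ D}` put `a(r) = K(r⁺ ∪ R)`, `b(r) = K((rᶜ)⁺ ∪ (D ∖ R))`.  Then for every
monotone `g`:  `0 ≤ Σ_r [¬(y ∈ a r ∧ y ∈ b r)]·([p ∈ a r] − [p ∈ b r])·(g(a r) − g(b r))`.  (For `f = 1_u` and `y ∼ u` this signs every star class of NO-CORE(y) with the edge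
`yu` red; the classes with `yu` blue are the colour-swapped images of these — part 2.)  [cite: KozmaNitzan2024, Questions 8–9 (§5.5 p. 36) (context)] -/
theorem starClass_nonneg_of_pointIndicator (D R : Finset ι) (hRD : R ⊆ D) {y p : V} (hD : ∀ i ∈ D, y ∈ ends i)
    {e₀ : ι} (he₀ : ends e₀ = s(y, p)) (hpy : p ≠ y) (he₀R : e₀ ∈ R) (g : Set V → ℝ) (hg : Monotone g) :
    0 ≤ ∑ r : Finset {j : ι // j ∉ D},
      (if ¬ (y ∈ openCluster (ends '' (↑(r.map (Function.Embedding.subtype _) ∪ R) : Set ι)) x ∧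
              y ∈ openCluster (ends '' (↑(rᶜ.map (Function.Embedding.subtype _) ∪ (D \ R)) : Set ι)) x) then
        ((if p ∈ openCluster (ends '' (↑(r.map (Function.Embedding.subtype _) ∪ R) : Set ι)) x then (1 : ℝ) else 0) -
          (if p ∈ openCluster (ends '' (↑(rᶜ.map (Function.Embedding.subtype _) ∪ (D \ R)) : Set ι)) x then (1 : ℝ) else 0)) *
        (g (openCluster (ends '' (↑(r.map (Function.Embedding.subtype _) ∪ R) : Set ι)) x) -
          g (openCluster (ends '' (↑(rᶜ.map (Function.Embedding.subtype _) ∪ (D \ R)) : Set ι)) x))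
      else 0) := by
  set emb := Function.Embedding.subtype (fun j : ι => j ∉ D) with hemb
  -- the four cluster functions of the class and of its swapped class
  set a : Finset {j : ι // j ∉ D} → Set V := fun r => openCluster (ends '' (↑(r.map emb ∪ R) : Set ι)) x with ha
  set a' : Finset {j : ι // j ∉ D} → Set V := fun r => openCluster (ends '' (↑(r.map emb ∪ (D \ R)) : Set ι)) x with ha'
  have hb : ∀ r : Finset {j : ι // j ∉ D}, openCluster (ends '' (↑(rᶜ.map emb ∪ (D \ R)) : Set ι)) x = a' rᶜ := fun r => rfl
  change 0 ≤ ∑ r : Finset {j : ι // j ∉ D}, (if ¬ (y ∈ a r ∧ y ∈ a' rᶜ) then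
    ((if p ∈ a r then (1 : ℝ) else 0) - (if p ∈ a' rᶜ then (1 : ℝ) else 0)) * (g (a r) - g (a' rᶜ)) else 0)
  -- monotonicity
  have hmono_union : ∀ {r t : Finset {j : ι // j ∉ D}} (X : Finset ι), r ⊆ t → r.map emb ∪ X ⊆ t.map emb ∪ X :=
    fun X hrt => Finset.union_subset_union (Finset.map_subset_map.mpr hrt) (le_refl X)
  have ha_mono : Monotone a := fun r t hrt => openCluster_image_mono ends (hmono_union R hrt) x
  have ha'_mono : Monotone a' := fun r t hrt => openCluster_image_mono ends (hmono_union (D \ R) hrt) x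
  -- [y ∈ a r] ↔ [p ∈ a r] (the red edge e₀ ∈ R) and likewise for a rᶜ
  have hya : ∀ r, y ∈ a r ↔ p ∈ a r := fun r =>
    mem_openCluster_iff_of_edge ends x (r.map emb ∪ R) he₀ hpy (Finset.mem_union_right _ he₀R)
  -- inactive stars: y ∉ a' t ⇒ a' t ⊆ a t  and  y ∉ a t ⇒ a t ⊆ a' t
  have hDR : ∀ i ∈ D \ R, y ∈ ends i := fun i hi => hD i (Finset.mem_sdiff.mp hi).1
  have hRy : ∀ i ∈ R, y ∈ ends i := fun i hi => hD i (hRD hi)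
  have inact1 : ∀ t : Finset {j : ι // j ∉ D}, y ∉ a' t → a' t ⊆ a t := by
    intro t hy v hv
    have h1 := openCluster_union_star_subset ends x (t.map emb) (D \ R) hDR hy hv
    exact openCluster_image_mono ends Finset.subset_union_left x h1
  have inact2 : ∀ t : Finset {j : ι // j ∉ D}, y ∉ a t → a t ⊆ a' t := by
    intro t hy v hv
    have h1 := openCluster_union_star_subset ends x (t.map emb) R hRy hy hv
    exact openCluster_image_mono ends Finset.subset_union_left x h1
  -- the weights
  set E₁ : Finset {j : ι // j ∉ D} → ℝ := fun r => if (p ∈ a r ∧ p ∉ a' rᶜ ∧ y ∉ a' rᶜ) then (1 : ℝ) else 0 with hE₁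
  set E₂ : Finset {j : ι // j ∉ D} → ℝ := fun r => if (p ∈ a' r ∧ p ∉ a rᶜ) then (1 : ℝ) else 0 with hE₂
  set N₂ : Finset {j : ι // j ∉ D} → ℝ := fun r => if (p ∉ a r ∧ p ∈ a' rᶜ) then (1 : ℝ) else 0 with hN₂
  -- pointwise: summand = E₁·(g a − g b) − N₂·(g a − g b)
  have hpt : ∀ r : Finset {j : ι // j ∉ D}, (if ¬ (y ∈ a r ∧ y ∈ a' rᶜ) then
      ((if p ∈ a r then (1 : ℝ) else 0) - (if p ∈ a' rᶜ then (1 : ℝ) else 0)) * (g (a r) - g (a' rᶜ)) else 0) =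
      E₁ r * (g (a r) - g (a' rᶜ)) - N₂ r * (g (a r) - g (a' rᶜ)) := by
    intro r
    simp only [hE₁, hN₂, hya r]
    by_cases h1 : p ∈ a r <;> by_cases h2 : p ∈ a' rᶜ <;> by_cases h3 : y ∈ a' rᶜ <;> simp [h1, h2, h3]
  rw [Finset.sum_congr rfl (fun r _ => hpt r), Finset.sum_sub_distrib]
  -- fold the N₂ part through the swap r ↦ rᶜ: it becomes −Σ E₂·(g a′ − g b′)
  have hswap : ∑ r : Finset {j : ι // j ∉ D}, N₂ r * (g (a r) - g (a' rᶜ)) = - ∑ r : Finset {j : ι // j ∉ D}, E₂ r * (g (a' r) - g (a rᶜ)) := by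
    rw [← Fintype.sum_equiv (Equiv.mk (fun r : Finset {j : ι // j ∉ D} => rᶜ) (fun r => rᶜ) (fun r => compl_compl r) (fun r => compl_compl r))
      (fun r => N₂ rᶜ * (g (a rᶜ) - g (a' rᶜᶜ))) (fun r => N₂ r * (g (a r) - g (a' rᶜ))) (fun r => by simp only [Equiv.coe_fn_mk]),
      ← Finset.sum_neg_distrib]
    refine Finset.sum_congr rfl fun r _ => ?_
    have hNE : N₂ rᶜ = E₂ r := by
      simp only [hN₂, hE₂, compl_compl]
      by_cases h1 : p ∈ a' r <;> by_cases h2 : p ∈ a rᶜ <;> simp [h1, h2]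
    rw [hNE, compl_compl]; ring
  rw [hswap, sub_neg_eq_add]
  -- the four brackets
  have hE₁_mono : Monotone E₁ := by
    intro r t hrt
    simp only [hE₁]
    by_cases hr : p ∈ a r ∧ p ∉ a' rᶜ ∧ y ∉ a' rᶜ
    · have hc : a' tᶜ ⊆ a' rᶜ := ha'_mono (compl_subset_compl.mpr hrt)
      have ht : p ∈ a t ∧ p ∉ a' tᶜ ∧ y ∉ a' tᶜ := ⟨ha_mono hrt hr.1, fun h => hr.2.1 (hc h), fun h => hr.2.2 (hc h)⟩
      simp [hr, ht]
    · simp only [hr, if_false]; split_ifs <;> norm_num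
  have hE₂_mono : Monotone E₂ := by
    intro r t hrt
    simp only [hE₂]
    by_cases hr : p ∈ a' r ∧ p ∉ a rᶜ
    · have hc : a tᶜ ⊆ a rᶜ := ha_mono (compl_subset_compl.mpr hrt)
      have ht : p ∈ a' t ∧ p ∉ a tᶜ := ⟨ha'_mono hrt hr.1, fun h => hr.2 (hc h)⟩
      simp [hr, ht]
    · simp only [hr, if_false]; split_ifs <;> norm_num
  have hB1 : 0 ≤ ∑ r : Finset {j : ι // j ∉ D}, E₁ r * (g (a r) - g (a rᶜ)) :=
    AntitheticProduct.sum_mul_sub_compl_nonneg E₁ (fun r => g (a r)) hE₁_mono (fun r t hrt => hg (ha_mono hrt))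
  have hB2 : 0 ≤ ∑ r : Finset {j : ι // j ∉ D}, E₁ r * (g (a rᶜ) - g (a' rᶜ)) := by
    refine Finset.sum_nonneg fun r _ => ?_
    simp only [hE₁]
    split_ifs with h
    · have hsub : a' rᶜ ⊆ a rᶜ := inact1 rᶜ h.2.2
      have := hg hsub
      linarith
    · simp
  have hB3 : 0 ≤ ∑ r : Finset {j : ι // j ∉ D}, E₂ r * (g (a' r) - g (a' rᶜ)) :=
    AntitheticProduct.sum_mul_sub_compl_nonneg E₂ (fun r => g (a' r)) hE₂_mono (fun r t hrt => hg (ha'_mono hrt))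
  have hB4 : 0 ≤ ∑ r : Finset {j : ι // j ∉ D}, E₂ r * (g (a' rᶜ) - g (a rᶜ)) := by
    refine Finset.sum_nonneg fun r _ => ?_
    simp only [hE₂]
    split_ifs with h
    · have hy : y ∉ a rᶜ := fun hy => h.2 ((hya rᶜ).mp hy)
      have hsub : a rᶜ ⊆ a' rᶜ := inact2 rᶜ hy
      have := hg hsub
      linarith
    · simp
  have hsplit1 : ∑ r : Finset {j : ι // j ∉ D}, E₁ r * (g (a r) - g (a' rᶜ)) =
      ∑ r : Finset {j : ι // j ∉ D}, E₁ r * (g (a r) - g (a rᶜ)) + ∑ r : Finset {j : ι // j ∉ D}, E₁ r * (g (a rᶜ) - g (a' rᶜ)) := by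
    rw [← Finset.sum_add_distrib]; refine Finset.sum_congr rfl fun r _ => ?_; ring
  have hsplit2 : ∑ r : Finset {j : ι // j ∉ D}, E₂ r * (g (a' r) - g (a rᶜ)) =
      ∑ r : Finset {j : ι // j ∉ D}, E₂ r * (g (a' r) - g (a' rᶜ)) + ∑ r : Finset {j : ι // j ∉ D}, E₂ r * (g (a' rᶜ) - g (a rᶜ)) := by
    rw [← Finset.sum_add_distrib]; refine Finset.sum_congr rfl fun r _ => ?_; ring
  rw [hsplit1, hsplit2]
  linarith

end Coefficientwise

end Summit.CriticalPhenomena.PercolationContinuityZ3.Theorems
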